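import Summits.KontsevichZagierPeriods.KontsevichZagierPeriods.Theses.HermiteRigidity
import Literature.NumberTheory.Transcendental.SemialgebraicMapsProofs
import Literature.NumberTheory.EllipticCurves.EisensteinValuesAtI
import Literature.Analysis.SpecialFunctions.LemniscateConstant

/-!
# `RealEllipticSectorKernel` (stmt-KontsevichZagierPeriods-10632): a generator is an honest representation, not a relation

Negative-side support for the crux `RealEllipticSectorKernel` of route `HermiteRigidity`
(cdisprove unit; companion of `Negative/Core.lean`, commentary in
`Cruxes/RealEllipticSectorKernel/Disproof.lean`). LOAD-BEARING ANALYSIS of the hypothesis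
`KZ.eval c = 0`: at `(q₂, q₃) = (4, 0)`, i.e. `f = 4x³ − 4x = 4x(x−1)(x+1)`, the third family of
generators of the sector is `[σ'', 1/√f]` with `σ'' = (1, ∞)` (`sigma''_four_zero`), and this IS an
integral representation in the sense of the calculus — `ℚ`-semialgebraic domain and integrand,
absolutely integrable — whose value is the lemniscatic half-period
`∫₁^∞ dx/√(4x³ − 4x) = Γ(1/4)²/(4√(2π))` (tree: `GaussianLattice.integral_Ioi_inv_sqrt_cubic_scaling`,
`integral_Ioi_one_inv_sqrt_cube_sub_self`); integrability is read off from the non-zero value.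
Hence (`exists_generator_not_mem_relations`) a generator outside `KZ.relations` (soundness), and
the strengthening of the crux with `eval c = 0` (and the undischargeable rigidity) deleted —
"`closure S ≤ relations`" — is FALSE (`not_closure_le_relations`). The construction is also the
pattern the provers need for the normal forms `[σ, (α + βx)/√f]`: `√` of a rational function is
semialgebraic (`isSemialgebraicFunOn_aeval_div_aeval`, `IsSemialgebraicFunOn.sqrt_holds`), and a
closed-form non-zero value gives integrability for free.

Sources: M. Kontsevich, D. Zagier, *Periods* (2001), §§1.1–1.2; Yu. V. Nesterenko, P. Philippon
(eds.), LNM 1752 (2001), Ch. 1 §3 Remark ii (the lemniscatic integral). -/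

noncomputable section

namespace Summit.KontsevichZagierPeriods.RealEllipticSectorKernel.GeneratorNotRelation

open MeasureTheory Set
open Literature.NumberTheory.Transcendental Literature.ModelTheory.ExponentialFields

/-- `σ'' = (1, ∞)` for `(q₂, q₃) = (4, 0)` (the crux's root-free description of the unbounded
oval, specialised). [folklore] -/
theorem sigma''_four_zero :
    {p : Fin 1 → ℝ | 0 < 4 * p 0 ^ 3 - ((4 : ℚ) : ℝ) * p 0 - ((0 : ℚ) : ℝ) ∧
        ∀ t : ℝ, p 0 < t → 0 < 4 * t ^ 3 - ((4 : ℚ) : ℝ) * t - ((0 : ℚ) : ℝ)} = {p | 1 < p 0} := by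
  ext p
  simp only [mem_setOf_eq, Rat.cast_ofNat, Rat.cast_zero, sub_zero]
  constructor
  · rintro ⟨h0, hall⟩
    by_contra h1
    push Not at h1
    have hlt : p 0 < 1 / 2 := by nlinarith [h0, h1, sq_nonneg (p 0)]
    have := hall (1 / 2) hlt
    norm_num at this
  · intro h1
    refine ⟨by nlinarith [h1, sq_nonneg (p 0)], fun t ht => ?_⟩
    have h2 : 1 < t := by linarith
    nlinarith [h2, sq_nonneg t, mul_pos (by linarith : (0:ℝ) < t) (by nlinarith : (0:ℝ) < t ^ 2 - 1)]

/-- `(1, ∞) ⊆ ℝ¹` is `ℚ`-semialgebraic. [cite: BochnakCosteRoy1998, Def. 2.1.4] -/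
theorem isSemialgebraic_Ioi_one : IsSemialgebraic ℚ {p : Fin 1 → ℝ | 1 < p 0} := by
  convert isSemialgebraic_setOf_eval_pos (k := ℚ) (R := ℝ) (MvPolynomial.X 0 - 1 : MvPolynomial (Fin 1) ℚ)
    using 2 with p
  simp [sub_pos]

/-- `p ↦ 1/√(4(p 0)³ − 4(p 0))` is `ℚ`-semialgebraic on `(1, ∞)` (`√` of a rational function).
[cite: BochnakCosteRoy1998, §2.2] -/
theorem integrand_semialgebraic :
    IsSemialgebraicFunOn ℚ {p : Fin 1 → ℝ | 1 < p 0}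
      (fun p => 1 / Real.sqrt (4 * p 0 ^ 3 - ((4 : ℚ) : ℝ) * p 0 - ((0 : ℚ) : ℝ))) := by
  have hσ := isSemialgebraic_Ioi_one
  have hne : ∀ p ∈ {p : Fin 1 → ℝ | 1 < p 0},
      MvPolynomial.aeval p (4 * MvPolynomial.X 0 ^ 3 - 4 * MvPolynomial.X 0 : MvPolynomial (Fin 1) ℚ) ≠ 0 := by
    intro p hp
    have hp : 1 < p 0 := hp
    simp only [map_sub, map_mul, map_pow, MvPolynomial.aeval_X, map_ofNat]
    nlinarith [mul_pos (by linarith : (0:ℝ) < p 0) (by nlinarith : (0:ℝ) < p 0 ^ 2 - 1)]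
  have h1 := isSemialgebraicFunOn_aeval_div_aeval hσ (1 : MvPolynomial (Fin 1) ℚ)
    (4 * MvPolynomial.X 0 ^ 3 - 4 * MvPolynomial.X 0) hne
  have h2 : IsSemialgebraicFunOn ℚ {p : Fin 1 → ℝ | 1 < p 0}
      (fun p => 1 / (4 * p 0 ^ 3 - ((4 : ℚ) : ℝ) * p 0 - ((0 : ℚ) : ℝ))) := by
    refine h1.congr (fun p _ => ?_)
    simp only [map_one, map_sub, map_mul, map_pow, MvPolynomial.aeval_X, map_ofNat,
      Rat.cast_ofNat, Rat.cast_zero, sub_zero]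
  have h3 := IsSemialgebraicFunOn.sqrt_holds h2
  refine h3.congr (fun p _ => ?_)
  simp only [one_div, Real.sqrt_inv]

/-- The closed-form value `∫_{(1,∞)} dx/√(4x³−4x) = Γ(1/4)²/(4√(2π))` (lemniscatic half-period).
[cite: NesterenkoPhilippon2001, Ch. 1 §3 Remark ii] -/
theorem setIntegral_Ioi_one_eq :
    ∫ p in {p : Fin 1 → ℝ | 1 < p 0}, 1 / Real.sqrt (4 * p 0 ^ 3 - ((4 : ℚ) : ℝ) * p 0 - ((0 : ℚ) : ℝ)) =
      Real.Gamma (1 / 4) ^ 2 / (4 * Real.sqrt (2 * Real.pi)) := by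
  have he : MeasurePreserving (MeasurableEquiv.funUnique (Fin 1) ℝ) volume volume :=
    volume_preserving_funUnique (Fin 1) ℝ
  have hpre : {p : Fin 1 → ℝ | 1 < p 0} = (MeasurableEquiv.funUnique (Fin 1) ℝ) ⁻¹' Ioi 1 := by
    ext p; rfl
  have key := he.setIntegral_preimage_emb (MeasurableEquiv.funUnique (Fin 1) ℝ).measurableEmbedding
    (fun x : ℝ => 1 / Real.sqrt (4 * x ^ 3 - ((4 : ℚ) : ℝ) * x - ((0 : ℚ) : ℝ))) (Ioi 1)
  rw [hpre]
  rw [show (fun p : Fin 1 → ℝ => 1 / Real.sqrt (4 * p 0 ^ 3 - ((4 : ℚ) : ℝ) * p 0 - ((0 : ℚ) : ℝ))) =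
      fun p => (fun x : ℝ => 1 / Real.sqrt (4 * x ^ 3 - ((4 : ℚ) : ℝ) * x - ((0 : ℚ) : ℝ)))
        (MeasurableEquiv.funUnique (Fin 1) ℝ p)
      from rfl]
  rw [key]
  have hsc := Literature.NumberTheory.EllipticCurves.GaussianLattice.integral_Ioi_inv_sqrt_cubic_scaling
    (e := 1) one_pos
  have hcub : (fun x : ℝ => 1 / Real.sqrt (4 * x ^ 3 - ((4 : ℚ) : ℝ) * x - ((0 : ℚ) : ℝ))) =
      fun x => (Real.sqrt (4 * x ^ 3 - 4 * 1 ^ 2 * x))⁻¹ := by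
    funext x
    simp only [Rat.cast_ofNat, Rat.cast_zero, sub_zero, one_pow, mul_one, one_div]
  rw [hcub, hsc, Literature.Analysis.SpecialFunctions.integral_Ioi_one_inv_sqrt_cube_sub_self,
    Real.sqrt_one]
  ring

/-- The value is positive. [folklore] -/
theorem setIntegral_Ioi_one_pos :
    0 < ∫ p in {p : Fin 1 → ℝ | 1 < p 0},
      1 / Real.sqrt (4 * p 0 ^ 3 - ((4 : ℚ) : ℝ) * p 0 - ((0 : ℚ) : ℝ)) := by
  rw [setIntegral_Ioi_one_eq]
  have h1 : 0 < Real.Gamma (1 / 4) := Real.Gamma_pos_of_pos (by norm_num)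
  have h2 : 0 < Real.sqrt (2 * Real.pi) := Real.sqrt_pos.mpr (by positivity)
  positivity

/-- Integrability of the integrand on `(1, ∞)`, read off from the non-zero value. [folklore] -/
theorem integrableOn_integrand :
    IntegrableOn (fun p : Fin 1 → ℝ => 1 / Real.sqrt (4 * p 0 ^ 3 - ((4 : ℚ) : ℝ) * p 0 - ((0 : ℚ) : ℝ)))
      {p | 1 < p 0} := by
  by_contra h
  have h0 := integral_undef h
  have hpos := setIntegral_Ioi_one_pos
  rw [h0] at hpos
  exact lt_irrefl _ hpos

/-- **A sector generator is an honest representation and not a relation**: at `(q₂,q₃) = (4,0)`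
the generator `[(1,∞), 1/√(4x³−4x)]` exists as a `KZ.IntegralRep 1`, has value
`Γ(1/4)²/(4√(2π))`, and does not lie in `KZ.relations` (soundness `relations ≤ ker eval`).
[cite: KontsevichZagier2001, §1.2] -/
theorem exists_generator_not_mem_relations :
    ∃ r : KZ.IntegralRep 1, r.domain = {p | 1 < p 0} ∧
      r.integrand = (fun p => 1 / Real.sqrt (4 * p 0 ^ 3 - ((4 : ℚ) : ℝ) * p 0 - ((0 : ℚ) : ℝ))) ∧
      r.value = Real.Gamma (1 / 4) ^ 2 / (4 * Real.sqrt (2 * Real.pi)) ∧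
      KZ.of r ∉ KZ.relations := by
  refine ⟨⟨{p | 1 < p 0}, fun p => 1 / Real.sqrt (4 * p 0 ^ 3 - ((4 : ℚ) : ℝ) * p 0 - ((0 : ℚ) : ℝ)),
    isSemialgebraic_Ioi_one, integrand_semialgebraic, integrableOn_integrand⟩, rfl, rfl,
    setIntegral_Ioi_one_eq, fun h => ?_⟩
  have h0 := KZ.relations_le_ker_eval_holds h
  rw [AddMonoidHom.mem_ker, KZ.eval_of] at h0
  have hpos : (0 : ℝ) < _ := setIntegral_Ioi_one_pos
  exact absurd h0 hpos.ne'

/-- **`eval c = 0` is load-bearing** (with the undischargeable rigidity hypothesis deleted as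
well): the crux's data verbatim, conclusion "every element of the sector closure is a relation" —
FALSE, witness `(q₂,q₃) = (4,0)` and the generator of `exists_generator_not_mem_relations`.
[cite: KontsevichZagier2001, §1.2] -/
theorem not_closure_le_relations : ¬ (
    ∀ (q₂ q₃ : ℚ), 0 < (q₂ : ℝ) ^ 3 - 27 * (q₃ : ℝ) ^ 2 →
      let f : ℝ → ℝ := fun x => 4 * x ^ 3 - (q₂ : ℝ) * x - (q₃ : ℝ);
      let σ : Set (Fin 1 → ℝ) := {p | 0 < f (p 0) ∧ ∃ t : ℝ, p 0 < t ∧ f t < 0};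
      let σ' : Set (Fin 1 → ℝ) := {p | f (p 0) < 0 ∧ ∃ t : ℝ, t < p 0 ∧ 0 < f t};
      let σ'' : Set (Fin 1 → ℝ) := {p | 0 < f (p 0) ∧ ∀ t : ℝ, p 0 < t → 0 < f t};
      let S : Set KZ.FormalRep := {c | ∃ (r : KZ.IntegralRep 1) (m : ℕ), r.domain = σ ∧ Set.EqOn r.integrand (fun p => p 0 ^ m / Real.sqrt (f (p 0))) σ ∧ c = KZ.of r} ∪ {c | ∃ (r : KZ.IntegralRep 1) (m : ℕ), r.domain = σ' ∧ Set.EqOn r.integrand (fun p => p 0 ^ m / Real.sqrt (- f (p 0))) σ' ∧ c = KZ.of r} ∪ {c | ∃ (r : KZ.IntegralRep 1), r.domain = σ'' ∧ Set.EqOn r.integrand (fun p => 1 / Real.sqrt (f (p 0))) σ'' ∧ c = KZ.of r}; ∀ c ∈ AddSubgroup.closure S, c ∈ KZ.relations) := by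
  intro h
  obtain ⟨r, hd, hi, -, hnot⟩ := exists_generator_not_mem_relations
  refine hnot (h 4 0 (by norm_num) (KZ.of r) (AddSubgroup.subset_closure ?_))
  refine Or.inr ⟨r, ?_, ?_, rfl⟩
  · rw [hd, ← sigma''_four_zero]
  · intro p _
    rw [hi]

end Summit.KontsevichZagierPeriods.RealEllipticSectorKernel.GeneratorNotRelation

end
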